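import Mathlib
import HarnessLib
import Summits.RiemannHypothesis.RiemannHypothesis.Theses.MayerPairing

/-!
# RiemannHypothesis / MayerPairing — the target from strict σ-antitonicity of eigenvalue moduli

Route `RiemannHypothesis/MayerPairing`, item stmt-RiemannHypothesis-1473 (`Target`), helper file.

The monotonicity crux `UnitCircleCrossedOnce` forbids a continuous eigenvalue selection `σ ↦ Λ σ` of
Mayer's `L_{σ+iτ}` (`|τ| ≥ 7`, `0 < a < b < 1/2`) from having modulus `1` at both ends of `[a, b]`.
What the numerical experiments attached to items 1470/1473 actually test is the stronger, cleaner
property that the modulus of every such selection is STRICTLY DECREASING in `σ`: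
`‖Λ b‖ < ‖Λ a‖` whenever `a < b` (kit jobs j000036, j001168: all tracked moduli strictly decreasing at
the sampled heights; this session's continuous-τ sweep tests the same inequality on a grid).
This file records, kernel-checked, that this tested property implies the crux and hence, together
with the pairing crux, the target:

* `mayerPairing_unitCircleCrossedOnce_of_strictAnti` : strict antitonicity of selection moduli ⇒
  `UnitCircleCrossedOnce`;
* `mayerPairing_target_of_strictAnti` : … and `BranchPairing` ⇒ `Target`.

Mathlib only. References: D. Mayer, Bull. AMS 25 (1991) 55–60; C.-H. Chang and D. Mayer, Contemp.
Math. 290 (2001).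
-/

namespace Summit.RiemannHypothesis.RiemannHypothesis.Theorems

open Filter Topology
open Summit.RiemannHypothesis.RiemannHypothesis.Theses.MayerPairing

/-- **Strict σ-antitonicity of eigenvalue-selection moduli implies the monotonicity crux.** If for
every height `|τ| ≥ 7`, every `0 < a < b < 1/2` and every continuous selection `Λ` on `[a,b]` of
eigenvalues of Mayer's `L_{σ+iτ}` (inlined functional-equation predicate) one has `‖Λ b‖ < ‖Λ a‖`,
then no such selection has modulus `1` at both `a` and `b`, i.e. `UnitCircleCrossedOnce` holds.
This is the form of the crux that the numerical K1 tests certify on their windows. [folklore] -/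
theorem mayerPairing_unitCircleCrossedOnce_of_strictAnti
    (h : ∀ τ : ℝ, 7 ≤ |τ| → ∀ a b : ℝ, 0 < a → a < b → b < 1 / 2 → ∀ Λ : ℝ → ℂ,
      ContinuousOn Λ (Set.Icc a b) →
      (∀ σ ∈ Set.Icc a b, ∃ f : ℂ → ℂ, ∃ δ : ℝ, 0 < δ ∧ DifferentiableOn ℂ f {z : ℂ | -δ < z.re} ∧
        (∃ z : ℂ, 0 < z.re ∧ f z ≠ 0) ∧
        (∀ z : ℂ, -δ < z.re → Λ σ * (f z - f (z + 1)) =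
          (z + 1) ^ (-(2 * ((σ : ℂ) + (τ : ℂ) * Complex.I))) * f (1 / (z + 1))) ∧
        Tendsto (fun x : ℝ => Λ σ * f x -
          f 0 * ((x : ℂ) + 1) ^ (1 - 2 * ((σ : ℂ) + (τ : ℂ) * Complex.I)) /
          (2 * ((σ : ℂ) + (τ : ℂ) * Complex.I) - 1)) atTop (𝓝 0)) →
      ‖Λ b‖ < ‖Λ a‖) :
    UnitCircleCrossedOnce := by
  intro τ hτ a b ha hab hb Λ hΛ heig hnorm
  have hlt := h τ hτ a b ha hab hb Λ hΛ heig
  rw [hnorm.1, hnorm.2] at hlt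
  exact lt_irrefl _ hlt

/-- **The target from the tested monotonicity and the pairing crux.** Strict σ-antitonicity of the
moduli of continuous eigenvalue selections (the property the K1 numerics test) together with
`BranchPairing` gives `Target = UnitCircleCrossedOnce ∧ BranchPairing`. [folklore] -/
theorem mayerPairing_target_of_strictAnti
    (h : ∀ τ : ℝ, 7 ≤ |τ| → ∀ a b : ℝ, 0 < a → a < b → b < 1 / 2 → ∀ Λ : ℝ → ℂ,
      ContinuousOn Λ (Set.Icc a b) →
      (∀ σ ∈ Set.Icc a b, ∃ f : ℂ → ℂ, ∃ δ : ℝ, 0 < δ ∧ DifferentiableOn ℂ f {z : ℂ | -δ < z.re} ∧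
        (∃ z : ℂ, 0 < z.re ∧ f z ≠ 0) ∧
        (∀ z : ℂ, -δ < z.re → Λ σ * (f z - f (z + 1)) =
          (z + 1) ^ (-(2 * ((σ : ℂ) + (τ : ℂ) * Complex.I))) * f (1 / (z + 1))) ∧
        Tendsto (fun x : ℝ => Λ σ * f x -
          f 0 * ((x : ℂ) + 1) ^ (1 - 2 * ((σ : ℂ) + (τ : ℂ) * Complex.I)) /
          (2 * ((σ : ℂ) + (τ : ℂ) * Complex.I) - 1)) atTop (𝓝 0)) →
      ‖Λ b‖ < ‖Λ a‖)
    (hB : BranchPairing) : Target :=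
  ⟨mayerPairing_unitCircleCrossedOnce_of_strictAnti h, hB⟩

end Summit.RiemannHypothesis.RiemannHypothesis.Theorems
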